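import Mathlib.MeasureTheory.Function.ConditionalExpectation.Basic
import Mathlib.Topology.MetricSpace.Thickening
import Literature.MathematicalPhysics.QuantumLattice.GermMarkov
import HarnessLib

/-!
# Local measurability of one random field with respect to another

Notion requested by route `CriticalPhenomena/GammaForcesInteraction` (foreseen split of
`GaussianNoPowerDeficiency`, hypothesis (EM) "the rescaled energy field is locally measurable with
respect to the spin field"). For a joint law `μ` of a pair `(Φ, Ψ)` of random tempered
distributions — a measure on `FieldConfig E × FieldConfig E` (file `RandomField`) — the second
field `Ψ` is *locally measurable with respect to the first* if every smeared value `Ψ(h)` is, up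
to a `μ`-null set, a function of the restriction of `Φ` to an arbitrarily small neighbourhood of
`supp h`:

  for every test function `h` and every `ε > 0`, `(Φ, Ψ) ↦ Ψ(h)` is `μ`-a.e. equal to a function
  measurable with respect to `σ((Φ, Ψ) ↦ Φ(f) : supp f ⊆ (supp h)^ε)`.

* `fstFieldSigma U` — the σ-algebra on pairs `(Φ, Ψ)` generated by the first field in the region
  `U ⊆ E`, i.e. the pull-back along `Prod.fst` of the region σ-algebra
  `fieldSigma U = σ(ω ↦ ω f : tsupport f ⊆ U)` of `GermMarkov` (Rozanov's `𝒜(U)`); it *is* the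
  σ-algebra generated by the maps `(Φ, Ψ) ↦ Φ(f)`, `tsupport f ⊆ U` (`fstFieldSigma_eq_iSup`).
* `IsLocallyMeasurableField μ` — the predicate above, phrased with Mathlib's
  `AEStronglyMeasurable[m] · μ` ("a.e. equal to an `m`-strongly-measurable function"; for real
  values the same as `m`-measurable, `isLocallyMeasurableField_iff`).
* API: monotonicity of `fstFieldSigma`, measurability of the generators, reduction to small `ε`
  (`IsLocallyMeasurableField.of_small`), the germ form implies it
  (`IsLocallyMeasurableField.of_germSigma`), each `Ψ(h)` is a.e. a function of the whole field `Φ`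
  (`IsLocallyMeasurableField.aestronglyMeasurable_comap_fst`), and the way the hypothesis is
  consumed: `Ψ(h)` is its own conditional expectation given the first field near `supp h`
  (`IsLocallyMeasurableField.condExp_snd_eval`).

## Sources

* Yu. A. Rozanov, *Markov Random Fields* (Springer 1982), Ch. 2 §1.3 (pp. 62–65): the σ-algebra
  of events `𝒜(S)` of a generalized random function `(u, ξ)`, generated by the `(u, ξ)` with
  `Supp u ⊆ S` (`S` open); monotonicity (1.25); the germ σ-algebras `𝒜₊(S) = ⋂_{ε>0} 𝒜(S^ε)` of an
  arbitrary set `S`.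
* J. Glimm, A. Jaffe, *Quantum Physics* (2nd ed. 1987), §10.5 (p. 200): `ℰ(Λ) ⊆ L₂(𝒟', dμ)`, the
  subspace generated by `e^{iφ(f)}` with `suppt f ⊆ Λ`, `Λ` open — the `L₂` form of `𝒜(Λ)`
  ("functions of the field in `Λ`").
* S. Janson, *Gaussian Hilbert Spaces* (CUP 1997), Ch. 1–2: for Gaussian `Φ`, `L²` of the
  σ-algebra generated by a Gaussian Hilbert space is the orthogonal sum of its Wiener chaoses — how
  the requesting route reads the hypothesis for a Gaussian spin field (not formalised here).

## Mathlib

Used: `MeasureTheory.AEStronglyMeasurable` with an explicit sub-σ-algebra (notation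
`AEStronglyMeasurable[m]`, the form consumed by `MeasureTheory.condExp`),
`AEStronglyMeasurable.mono` (monotone in `m`), `stronglyMeasurable_iff_measurable`,
`MeasurableSpace.comap` / `comap_iSup` / `comap_comp` / `comap_mono`, `comap_measurable`,
`MeasureTheory.condExp_of_aestronglyMeasurable'`, `Metric.thickening`. From `GermMarkov`:
`fieldSigma`, `fieldSigma_mono`, `fieldSigma_le`, `measurable_eval_fieldSigma`, `germSigma`,
`germSigma_le_fieldSigma_thickening`. Verified absent at the pin: any notion of measurability of
one random field / process relative to the local σ-algebras of another
(`lean search 'IsLocallyMeasurable|LocallyMeasurable'`); Lévy's downward (backward-martingale)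
theorem.

## Design and caveats

* The joint law lives on the product measurable space `FieldConfig E × FieldConfig E` (product of
  the two Borel σ-algebras, Mathlib's `Prod.instMeasurableSpace`), as every law in `RandomField`
  lives on `FieldConfig E`; a pair of random fields `Φ, Ψ : Ω → FieldConfig E` on a probability
  space is handled through its joint law `P.map fun x => (Φ x, Ψ x)`. Everything is stated for a
  general real normed space `E`; consumers take `E = EuclideanSpace ℝ (Fin d)`.
* `supp h` is the closed support `tsupport h`, its `ε`-neighbourhood the open thickening
  `Metric.thickening ε (tsupport h)`. Because the condition is imposed for every `ε > 0` and the
  σ-algebras increase with the region (`fstFieldSigma_mono`), open or closed neighbourhoods give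
  the same predicate, and it suffices to check all small `ε` (`IsLocallyMeasurableField.of_small`).
* Relation to germ σ-algebras. A.e.-equality with a function measurable for the germ σ-algebra
  `𝒜_Φ,₊(supp h) = ⋂_ε 𝒜_Φ((supp h)^ε)` (`germSigma`, pulled back along `Prod.fst`) implies the
  ε-by-ε condition (`IsLocallyMeasurableField.of_germSigma`). For a finite measure the converse also
  holds — an `L¹` variable that is a.e. equal to an `𝒜(S^{1/n})`-measurable one for every `n`
  equals its conditional expectations `E[· | 𝒜(S^{1/n})]`, which converge a.e. to
  `E[· | ⋂_n 𝒜(S^{1/n})]` by Lévy's downward theorem — so the definition is "`Ψ(h)` is measurable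
  for the `μ`-completed germ σ-algebra of `Φ` at `supp h`". The converse is not formalised (no
  backward-martingale convergence theorem in Mathlib at the pin); the definition is the ε-by-ε
  statement of the request.
* Degenerate cases: for `h = 0`, `tsupport h = ∅`, the region σ-algebra is trivial and `Ψ(0) = 0`
  is constant, so the condition holds, as it should. The predicate is meaningful for any measure;
  consumers assume `[IsProbabilityMeasure μ]`. The diagonal law `ν.map fun ω => (ω, ω)` (`Ψ = Φ`)
  satisfies it (checked in a scratch file, not shipped).
* Not here: the Gaussian/Wiener-chaos transcription (Janson), and the general-`Ω` formulation.
-/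

open scoped SchwartzMap
open MeasureTheory

namespace Literature.MathematicalPhysics.QuantumLattice

variable {E : Type*} [NormedAddCommGroup E] [NormedSpace ℝ E]

/-! ### The σ-algebra of the first field in a region -/

/-- The σ-algebra on pairs of field configurations `(Φ, Ψ)` generated by the *first* field in the
region `U ⊆ E`: the pull-back along `Prod.fst` of `fieldSigma U = σ(ω ↦ ω f : tsupport f ⊆ U)`,
equivalently (`fstFieldSigma_eq_iSup`) the smallest σ-algebra making every `(Φ, Ψ) ↦ Φ f` with
`tsupport f ⊆ U` measurable. Rozanov's `𝒜(U)` of the generalized random function `Φ`.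
[cite: Rozanov1982, Ch. 2 §1.3] -/
@[reducible] noncomputable def fstFieldSigma (U : Set E) :
    MeasurableSpace (FieldConfig E × FieldConfig E) :=
  (fieldSigma U).comap Prod.fst

/-- `fstFieldSigma U` is the σ-algebra generated by the evaluations of the first field at test
functions supported in `U`. [folklore] -/
theorem fstFieldSigma_eq_iSup (U : Set E) :
    fstFieldSigma U = ⨆ f : {f : 𝓢(E, ℝ) // tsupport f ⊆ U},
      MeasurableSpace.comap (fun p : FieldConfig E × FieldConfig E => p.1 f.1) inferInstance := by
  simp only [fstFieldSigma, fieldSigma, MeasurableSpace.comap_iSup, MeasurableSpace.comap_comp]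
  rfl

/-- `fstFieldSigma` is monotone in the region (Rozanov (1.25)). [folklore] -/
theorem fstFieldSigma_mono {U V : Set E} (h : U ⊆ V) :
    fstFieldSigma (E := E) U ≤ fstFieldSigma V :=
  MeasurableSpace.comap_mono (fieldSigma_mono h)

/-- `fstFieldSigma U` is a sub-σ-algebra of the product σ-algebra on `FieldConfig E × FieldConfig E`.
[folklore] -/
theorem fstFieldSigma_le (U : Set E) :
    fstFieldSigma (E := E) U ≤ (inferInstance : MeasurableSpace (FieldConfig E × FieldConfig E)) :=
  (MeasurableSpace.comap_mono (fieldSigma_le U)).trans measurable_fst.comap_le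

/-- The evaluation `(Φ, Ψ) ↦ Φ f` of the first field at a test function supported in `U` is
`fstFieldSigma U`-measurable. [folklore] -/
theorem measurable_fst_eval_fstFieldSigma {U : Set E} {f : 𝓢(E, ℝ)} (hf : tsupport f ⊆ U) :
    Measurable[fstFieldSigma U] fun p : FieldConfig E × FieldConfig E => p.1 f :=
  (measurable_eval_fieldSigma hf).comp (comap_measurable Prod.fst)

/-! ### Local measurability of the second field with respect to the first -/

/-- **Local measurability** of the second field with respect to the first, for a joint law `μ` of
a pair `(Φ, Ψ)` of random tempered distributions ("`Ψ` is a local function of `Φ`"): for every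
test function `h` and every `ε > 0`, the random variable `(Φ, Ψ) ↦ Ψ h` is `μ`-a.e. equal to a
function measurable with respect to
`fstFieldSigma (Metric.thickening ε (tsupport h)) = σ((Φ, Ψ) ↦ Φ f : tsupport f ⊆ (supp h)^ε)`,
the σ-algebra of the first field in the `ε`-neighbourhood of `supp h` — Rozanov's `𝒜((supp h)^ε)`
(1982, Ch. 2 §1.3); for all `ε` at once, his germ σ-algebra `𝒜₊(supp h)` (module docstring);
Glimm–Jaffe (1987) §10.5 for "functions of the field in a region". Stated with Mathlib's
`AEStronglyMeasurable[m]`; unfolded in `isLocallyMeasurableField_iff`. [folklore] -/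
def IsLocallyMeasurableField (μ : Measure (FieldConfig E × FieldConfig E)) : Prop :=
  ∀ (h : 𝓢(E, ℝ)) (ε : ℝ), 0 < ε →
    AEStronglyMeasurable[fstFieldSigma (Metric.thickening ε (tsupport h))]
      (fun p : FieldConfig E × FieldConfig E => p.2 h) μ

/-- Unfolding lemma: `IsLocallyMeasurableField μ` says that each `(Φ, Ψ) ↦ Ψ h` is `μ`-a.e. equal
to a real function measurable for the σ-algebra generated by the `(Φ, Ψ) ↦ Φ f`,
`tsupport f ⊆ (tsupport h)^ε`, for every `ε > 0`. [folklore] -/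
theorem isLocallyMeasurableField_iff (μ : Measure (FieldConfig E × FieldConfig E)) :
    IsLocallyMeasurableField μ ↔ ∀ (h : 𝓢(E, ℝ)) (ε : ℝ), 0 < ε →
      ∃ g : FieldConfig E × FieldConfig E → ℝ,
        Measurable[fstFieldSigma (Metric.thickening ε (tsupport h))] g ∧
          (fun p : FieldConfig E × FieldConfig E => p.2 h) =ᵐ[μ] g := by
  simp only [IsLocallyMeasurableField, AEStronglyMeasurable, stronglyMeasurable_iff_measurable]

/-- Local measurability is monotone in the neighbourhood: a version of `Ψ h` measurable for the
first field in `(supp h)^ε` is also one for `(supp h)^δ`, `ε ≤ δ`. [folklore] -/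
theorem IsLocallyMeasurableField.aestronglyMeasurable_of_le
    {μ : Measure (FieldConfig E × FieldConfig E)} (hμ : IsLocallyMeasurableField μ) (h : 𝓢(E, ℝ))
    {ε δ : ℝ} (hε : 0 < ε) (hεδ : ε ≤ δ) :
    AEStronglyMeasurable[fstFieldSigma (Metric.thickening δ (tsupport h))]
      (fun p : FieldConfig E × FieldConfig E => p.2 h) μ :=
  (hμ h ε hε).mono (fstFieldSigma_mono (Metric.thickening_mono hεδ _))

/-- It suffices to check local measurability for all sufficiently small `ε` (depending on `h`).
[folklore] -/
theorem IsLocallyMeasurableField.of_small {μ : Measure (FieldConfig E × FieldConfig E)}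
    (hμ : ∀ h : 𝓢(E, ℝ), ∃ ε₀ : ℝ, 0 < ε₀ ∧ ∀ ε : ℝ, 0 < ε → ε ≤ ε₀ →
      AEStronglyMeasurable[fstFieldSigma (Metric.thickening ε (tsupport h))]
        (fun p : FieldConfig E × FieldConfig E => p.2 h) μ) :
    IsLocallyMeasurableField μ := by
  intro h ε hε
  obtain ⟨ε₀, hε₀, H⟩ := hμ h
  exact (H (min ε ε₀) (lt_min hε hε₀) (min_le_right _ _)).mono
    (fstFieldSigma_mono (Metric.thickening_mono (min_le_left _ _) _))

/-- In particular each `Ψ h` is `μ`-a.e. a function of the whole first field `Φ`: measurable for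
`σ(Φ)`, the pull-back along `Prod.fst` of the Borel σ-algebra of `FieldConfig E`. [folklore] -/
theorem IsLocallyMeasurableField.aestronglyMeasurable_comap_fst
    {μ : Measure (FieldConfig E × FieldConfig E)} (hμ : IsLocallyMeasurableField μ) (h : 𝓢(E, ℝ)) :
    AEStronglyMeasurable[MeasurableSpace.comap Prod.fst FieldConfig.instMeasurableSpace]
      (fun p : FieldConfig E × FieldConfig E => p.2 h) μ :=
  (hμ h 1 one_pos).mono (MeasurableSpace.comap_mono (fieldSigma_le _))

/-- The germ form implies local measurability: if each `Ψ h` is `μ`-a.e. equal to a function of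
the germ of the first field at `supp h` (measurable for `germSigma (tsupport h)` pulled back along
`Prod.fst`), then `IsLocallyMeasurableField μ` (since `𝒜₊(S) ≤ 𝒜(S^ε)`). For finite `μ` the
converse holds by Lévy's downward theorem (module docstring; not formalised). [folklore] -/
theorem IsLocallyMeasurableField.of_germSigma {μ : Measure (FieldConfig E × FieldConfig E)}
    (hμ : ∀ h : 𝓢(E, ℝ), AEStronglyMeasurable[(germSigma (tsupport h)).comap Prod.fst]
      (fun p : FieldConfig E × FieldConfig E => p.2 h) μ) :
    IsLocallyMeasurableField μ :=
  fun h _ε hε => (hμ h).mono (MeasurableSpace.comap_mono (germSigma_le_fieldSigma_thickening _ hε))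

/-- How the hypothesis is consumed: under a finite joint law with `Ψ h` integrable, local
measurability makes `Ψ h` (a.e.) its own conditional expectation given the first field in any
`ε`-neighbourhood of `supp h` (Mathlib `condExp_of_aestronglyMeasurable'`). [folklore] -/
theorem IsLocallyMeasurableField.condExp_snd_eval {μ : Measure (FieldConfig E × FieldConfig E)}
    [IsFiniteMeasure μ] (hμ : IsLocallyMeasurableField μ) (h : 𝓢(E, ℝ)) {ε : ℝ} (hε : 0 < ε)
    (hint : Integrable (fun p : FieldConfig E × FieldConfig E => p.2 h) μ) :
    μ[fun p : FieldConfig E × FieldConfig E => p.2 h | fstFieldSigma (Metric.thickening ε (tsupport h))]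
      =ᵐ[μ] fun p : FieldConfig E × FieldConfig E => p.2 h :=
  condExp_of_aestronglyMeasurable' (fstFieldSigma_le _) (hμ h ε hε) hint

end Literature.MathematicalPhysics.QuantumLattice
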